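/-
Copyright: the b2b-balaban T⁴-continuum CRUX team, row NE7b OWNER lineage `t4-ne7b-p1` (gen 147). Project licence.
-/
import Summits.QuantumFields.BalabanUV.T4Continuum.Spine.NE7b.SupWeightedFifthOrderOutputFive
import Summits.QuantumFields.BalabanUV.T4Continuum.Spine.NE7b.SupWeightedFamilyProfiles
import Summits.QuantumFields.BalabanUV.T4Continuum.Spine.NE7b.SupWeightedFamilyProfilesK4
import Summits.QuantumFields.BalabanUV.T4Continuum.Spine.NE7b.SupWeightedFamilyProfilesK5
import Summits.QuantumFields.BalabanUV.T4Continuum.Spine.NE7b.SupWeightedProfileDischarge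

/-!
# THE WEIGHTED CLASS MAP PACKAGED — ORDER FIVE, DERIVATIVE SLOT `s` (SCOPING-d17 (d14)(3) ∕ SCOPING-d18 §E F20; file (760) of (748)–(762)).
# The weighted class (SCOPING-d17 §C–§D, the repair of the located NO (648)) carries per order the INTRINSIC full-graph `ϑ₂`-letters of the
# derivative majorants `Hk, K3, K4, K5` in their SLOT shapes; (743) proved the corresponding statement for the OUTPUT of the
# fluctuation step `W⁺(ψ) = −log∫e^{−U(·+ψ)}dμ_{AAᵀ}` at the weaker weight `ϑ` GIVEN the step's PROFILE letters (`αθ, βθ` of the decay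
# constants; `αθc, αg1m, αg2m, αg1c, αk4m·, αk4c, αk5m·, αk5c` of the two-point terms) as hypotheses on `A, Hk, K3, K4, K5, σ`.
# (659)∕(666)∕(738)∕(747) write every profile letter as intrinsic letter × factor letter (`Σ_{z′}|A_{uz′}|σA_{uz′} ≤ αrσ`, `Σ_u|A_{uz′}|σA_{uz′} ≤ αcσ`)
# under the one compatibility `σ_{vz′} ≤ ϑ₂(v,u)σA_{uz′}` (the triangle inequality for exponential weights).  THIS FILE substitutes them:
# (743)'s conclusion VERBATIM from (743)'s non-profile hypotheses + the factor's two weighted letters + the intrinsic `ϑ₂`-letters the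
# profiles consume (slot shapes; converted to (666)∕(738)'s mass shapes by (747)) + the scalar bookkeeping `intrinsic × factor ≤ letter`
# (`hrϑ·αrσ ≤ αθ`, `k3rϑ·αrσ ≤ αθ`, `k4ϑ1·αrσ ≤ αθ`, `αθ ≤ βθ`, `hcϑ·αcσ ≤ αθc`, …) — «ϑ₂-letters + factor letters in ⟹ ϑ-letters out», NO
# profile hypothesis, no support count, no range (row NE7b, node U5c; (743), (659)∕(666)∕(738)∕(747) BY NAME; [folklore]).  With (748)–(762) the
# weighted class map of row NE7b is a CLOSED one-step statement at orders 2–5 modulo the rate bookkeeping (672)∕(746).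

Cell `pub-balaban`, sub-cell `t4`, spine estimate NE7b (`T4WeightBudget.RelWeightBound`; the cell's OWN estimate — NOT PRINTED in
[Bałaban 1983–89], NOT PROVED).  Crux-route work under `Spine/NE7b/` by the row OWNER (`t4-ne7b-p1` gen 147, file (760)) under FREEZE
(0)'s crux-prover clause; NOTHING of Bałaban's is named as a Lean object, valued or asserted; no `T4Continuum/Support` leaf typed; no
`def`, no notation (the display and the bound WRITTEN OUT exactly as printed by the source file); zero `sorry`.  Imports (BY NAME): the
source file `…SupWeightedFifthOrderOutputFive`, (659) `…SupWeightedFamilyProfiles`, (666) `…SupWeightedFamilyProfilesK4`, (738) `…SupWeightedFamilyProfilesK5`,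
(747) `…SupWeightedProfileDischarge`.

WHAT IS PROVED ([folklore]): **`classmap_five_s`**; toy.

HONEST (what this is NOT).  One block of the per-order packaging (the other roles ∕ orders are the sibling files (748)–(762)); the
derivative∕continuity slots of the class carry no profile letter and are not restated; finite-torus Gaussian measure `μ_{AAᵀ}` with the
road's regularisation; the rates (which weights a scale admits, `L > 64` at order 4, `L > 384` at order 5 with the convenience exponents) are
(672)∕(746); scalar skeleton ((A3), NC-NE7b-α UNRULED); nothing of Bałaban's asserted.  BY-NAME EFFECT ON THE WALL: NONE.  NE7b NOT PRINTED ∕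
NOT PROVED; spine PROVED 0∕9; rung (B)+1 — the programme's measures remain FINITE-torus statements; NOT the mass gap, NOT Clay.  HONEST
DEPENDENCY: continuum YM on T⁴ ⇐ BetaPertH ∧ nine spine estimates (0∕9 proved); BetaPertH ⇐ (D1) ∧ (D4) ∧ CAP+tail; G-an2-4 gates asym,
D1 and NE2∕3∕4.
-/

set_option autoImplicit false
set_option maxSynthPendingDepth 4

noncomputable section

namespace Summit.QuantumFields.BalabanUV.T4Continuum.NE7b.SupWeightedClassMapOrderFiveFive

open MeasureTheory ProbabilityTheory Finset Real Matrix
open scoped BigOperators Matrix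
open SupWeightedFifthOrderOutputFive (fifth_derivative_weighted_slot_s)
open SupWeightedFamilyProfiles (hk_profile_row hk_profile_col k3_mass_first k3_mass_second k3_col_internal)
open SupWeightedFamilyProfilesK4 (k4_mass_1 k4_mass_2 k4_mass_3 k4_col_internal)
open SupWeightedFamilyProfilesK5 (k5_mass_1 k5_mass_2 k5_mass_3 k5_mass_4 k5_col_internal)
open SupWeightedProfileDischarge (hk_profile_point k3_profile_point k4_profile_point k3_profile_row k4_profile_row hk_row_of_slot
  hk_col_of_slot k4_mass_shape_1 k4_mass_shape_2 k4_mass_shape_3 k5_mass_shape_1 k5_mass_shape_2 k5_mass_shape_3 k5_mass_shape_4 letter_nonneg₁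
  letter_nonneg₂ letter_nonneg₃ letter_nonneg₄)

variable {ι κ : Type} [Fintype ι] [DecidableEq ι] [Fintype κ] [DecidableEq κ]
variable {U : EuclideanSpace ℝ ι → ℝ} {U' : EuclideanSpace ℝ ι → EuclideanSpace ℝ ι →L[ℝ] ℝ}
  {U'' : EuclideanSpace ℝ ι → EuclideanSpace ℝ ι →L[ℝ] EuclideanSpace ℝ ι →L[ℝ] ℝ}
  {U₃ : EuclideanSpace ℝ ι → EuclideanSpace ℝ ι →L[ℝ] EuclideanSpace ℝ ι →L[ℝ] EuclideanSpace ℝ ι →L[ℝ] ℝ}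
  {U₄ : EuclideanSpace ℝ ι → EuclideanSpace ℝ ι →L[ℝ] EuclideanSpace ℝ ι →L[ℝ] EuclideanSpace ℝ ι →L[ℝ] EuclideanSpace ℝ ι →L[ℝ] ℝ}
  {U₅ : EuclideanSpace ℝ ι →
    EuclideanSpace ℝ ι →L[ℝ] EuclideanSpace ℝ ι →L[ℝ] EuclideanSpace ℝ ι →L[ℝ] EuclideanSpace ℝ ι →L[ℝ] EuclideanSpace ℝ ι →L[ℝ] ℝ}
  {Hk : ι → ι → ℝ} {K3 : ι → ι → ι → ℝ} {K4 : ι → ι → ι → ι → ℝ} {K5 : ι → ι → ι → ι → ι → ℝ} {A : Matrix ι κ ℝ} {D : κ → κ → ℝ}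
  {γop κ₀ κ₁ κ₂ κ₃ κ₄ κ₅ κ₅r a τ δ θp lam lamA αr αc hr hc k3r k3c k4r k4c k5r k5c γ dr dc dθ dθ' αθ βθ S S' S₁ n₃ : ℝ} {θ : κ → κ → ℝ}
  {σ : ι → κ → ℝ} {ρ r r₁ : ι → ι → ℝ} {C3k C3h C4 C5 : ℝ}
  {ϑ ϑ₂ : ι → ι → ℝ} {αθc αg1m αg2m αg1c αk4m1 αk4m2 αk4m3 αk4c αk5m1 αk5m2 αk5m3 αk5m4 αk5c hrϑ hcϑ k3rϑ k3mϑ k3cϑ k5ϑ1 k5ϑ2 k5ϑ3 k5ϑ4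
    k5ϑ5 G Θ8 S2 : ℝ}
variable {σA : ι → κ → ℝ} {αrσ αcσ : ℝ}
variable {k4ϑ1 k4ϑ2 k4ϑ3 k4ϑ4 : ℝ}

set_option synthInstance.maxHeartbeats 200000 in
set_option maxHeartbeats 6000000 in
set_option maxRecDepth 4096 in
/-- **ORDER 5, DERIVATIVE SLOT `s` — THE WEIGHTED CLASS MAP PACKAGED**: for every background `ψ` and site `s`, the fifth `ψ`-derivative
entries of the one-step effective action `W⁺(ψ) = −log∫e^{−U(·+ψ)}dμ_{AAᵀ}` summed over the free slots against the full-graph weight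
`Πϑ` obey (743)'s bound — the weighted OUTPUT slot letter of `K5⁺ := |∂⁵W⁺|` in role `s` — from the road's step data, the weights'
compatibilities and geometry letters, the INPUT's intrinsic `ϑ₂`-letters (slot shapes), the factor's weighted letters `αrσ, αcσ` under
`σ_{vz′} ≤ ϑ₂(v,u)σA_{uz′}`, and the scalar bookkeeping `intrinsic × factor ≤ profile letter`; NO profile hypothesis ((659)∕(666)∕(738)∕(747)
discharge them inside). [folklore] -/
theorem classmap_five_s [Nonempty κ] (hΓop : (γop • (1 : Matrix ι ι ℝ) - A * Aᵀ).PosSemidef) (Y : Finset ι) (hUd : ∀ φ : EuclideanSpace ℝ ι, HasFDerivAt U (U' φ) φ) (hU'd : ∀ φ : EuclideanSpace ℝ ι, HasFDerivAt U' (U'' φ) φ)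
    (hU''d : ∀ φ : EuclideanSpace ℝ ι, HasFDerivAt U'' (U₃ φ) φ) (hU₃d : ∀ φ : EuclideanSpace ℝ ι, HasFDerivAt U₃ (U₄ φ) φ) (hU₄d : ∀ φ : EuclideanSpace ℝ ι, HasFDerivAt U₄ (U₅ φ) φ) (hU₅c : Continuous U₅) (hκ₀ : 0 ≤ κ₀)
    (hκ₁ : 0 ≤ κ₁) (ha : 0 ≤ a) (hτ : 0 < τ) (hδ : 0 < δ) (hθ0 : 0 < θp) (hθ1 : θp < 1) (hκθ : (2 * κ₀ * (1 + τ) + 4 * δ) * γop ≤ θp) (hκθw : 2 * κ₀ * (1 + τ) * γop + 4 * δ ≤ θp)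
    (hstab : ∀ φ : EuclideanSpace ℝ ι, -(κ₀ * ∑ x ∈ Y, φ x ^ 2) ≤ U φ) (hU'b : ∀ φ : EuclideanSpace ℝ ι, ‖U' φ‖ ≤ κ₁ * (a + ∑ x ∈ Y, φ x ^ 2)) (hU''b : ∀ φ : EuclideanSpace ℝ ι, ‖U'' φ‖ ≤ κ₂)
    (hU₃b : ∀ φ : EuclideanSpace ℝ ι, ‖U₃ φ‖ ≤ κ₃) (hU₄b : ∀ φ : EuclideanSpace ℝ ι, ‖U₄ φ‖ ≤ κ₄) (hU₅b : ∀ φ : EuclideanSpace ℝ ι, ‖U₅ φ‖ ≤ κ₅) (hlam : 0 ≤ lam)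
    (hUsec : ∀ s : ℝ, 0 ≤ s → s ≤ 1 → ∀ a b : EuclideanSpace ℝ ι, U ((1 - s) • a + s • b) - lam / 2 * (s * (1 - s)) * ∑ i, (a i - b i) ^ 2 ≤ (1 - s) * U a + s * U b) (hρg : lam * γop < 1)
    (hHk : ∀ (φ : EuclideanSpace ℝ ι) (x z : ι), |U'' φ (EuclideanSpace.single z (1 : ℝ)) (EuclideanSpace.single x (1 : ℝ))| ≤ Hk x z) (hHk0 : ∀ v u, 0 ≤ Hk v u)
    (hK3 : ∀ (φ : EuclideanSpace ℝ ι) (u x y : ι), |U₃ φ (EuclideanSpace.single u (1 : ℝ)) (EuclideanSpace.single x (1 : ℝ)) (EuclideanSpace.single y (1 : ℝ))| ≤ K3 x y u) (hK30 : ∀ x y u, 0 ≤ K3 x y u)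
    (hK4 : ∀ (φ : EuclideanSpace ℝ ι) (u x y z : ι), |U₄ φ (EuclideanSpace.single u (1 : ℝ)) (EuclideanSpace.single x (1 : ℝ)) (EuclideanSpace.single y (1 : ℝ)) (EuclideanSpace.single z (1 : ℝ))| ≤ K4 x y z u)
    (hK40 : ∀ x y z u, 0 ≤ K4 x y z u)
    (hK5 : ∀ (φ : EuclideanSpace ℝ ι) (u x y z t : ι), |U₅ φ (EuclideanSpace.single u (1 : ℝ)) (EuclideanSpace.single x (1 : ℝ)) (EuclideanSpace.single y (1 : ℝ)) (EuclideanSpace.single z (1 : ℝ))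
      (EuclideanSpace.single t (1 : ℝ))| ≤ K5 x y z t u) (hhr : ∀ v, ∑ u, Hk v u ≤ hr) (ψ : EuclideanSpace ℝ ι) (hαr : ∀ u, ∑ w, |A u w| ≤ αr) (hαc : ∀ w, ∑ u, |A u w| ≤ αc)
    (hlamA : ∀ x : κ, ∑ u, ∑ v, |A u x| * |A v x| * Hk v u ≤ lamA) (hlamA1 : lamA < 1) (hγ : αc * hr * αr / (1 - lamA) ≤ γ) (hγ1 : γ < 1) (hD : ∀ x y, 0 ≤ D x y)
    (hDC : ∀ x y, (if x = y then (1 : ℝ) else 0) + ∑ z, D x z * ((if y = z then 0 else ∑ u, ∑ v, |A u y| * |A v z| * Hk v u) / (1 - lamA)) ≤ D x y) (hθnn : ∀ z w, 0 ≤ θ z w) (hDθr : ∀ z, ∑ w, D z w * θ z w ≤ dθ) (hdθ : 0 ≤ dθ)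
    (hDθc : ∀ w, ∑ z, D z w * θ z w ≤ dθ') (hdθ' : 0 ≤ dθ') (hσ0 : ∀ x w, 0 ≤ σ x w) (hσθ : ∀ x z w, σ x w ≤ σ x z * θ z w) (hρ1 : ∀ x y, 1 ≤ ρ x y) (hρsymm : ∀ x y, ρ x y = ρ y x) (hρmul : ∀ x y z, ρ x z ≤ ρ x y * ρ y z)
    (hρσ : ∀ x y w, ρ x y ^ 8 ≤ σ x w * σ y w) (hr1 : ∀ x y, 1 ≤ r x y) (hrσ : ∀ x y w, r x y ^ 24 ≤ σ x w * σ y w)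
    (hC3k : 4 * Real.sqrt ((5 * ((κ₂ ^ 4 + κ₄ ^ 4) * γop ^ 2) / (1 - lam * γop) ^ 2) * (αθ * dθ * (βθ * dθ') / (1 - lamA))) ≤ C3k)
    (hC3h : 4 * Real.sqrt ((5 * ((κ₂ ^ 4 + κ₃ ^ 4) * γop ^ 2) / (1 - lam * γop) ^ 2) * (αθ * dθ * (βθ * dθ') / (1 - lamA))) ≤ C3h)
    (hC4 :
      (4 * (αθ * dθ * (βθ * dθ') / (1 - lamA)) + 3 * (αθ * dθ * (βθ * dθ') / (1 - lamA)) ^ 2 + 4 * (5 * ((κ₂ ^ 4 + κ₃ ^ 4) * γop ^ 2) / (1 - lam * γop) ^ 2) + 4 * (50 * ((κ₂ ^ 6 + κ₃ ^ 6) * γop ^ 3) / (1 - lam * γop) ^ 3) + 2 *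
        (((5 * ((κ₂ ^ 4 + κ₃ ^ 4) * γop ^ 2) / (1 - lam * γop) ^ 2) + 1) / 2) * ((((5 * ((κ₂ ^ 4 + κ₃ ^ 4) * γop ^ 2) / (1 - lam * γop) ^ 2) + 1) / 2) + (5 * ((κ₂ ^ 4 + κ₃ ^ 4) * γop ^ 2) / (1 - lam * γop) ^ 2))) ≤ C4)
    (hC5 :
      ((4 * (αθ * dθ * (βθ * dθ') / (1 - lamA)) + 5 * (50 * (κ₂ ^ 6 * γop ^ 3) / (1 - lam * γop) ^ 3) + (((5 * (κ₂ ^ 4 * γop ^ 2) / (1 - lam * γop) ^ 2) + 1) / 2) * (5 * (κ₂ ^ 4 * γop ^ 2) / (1 - lam * γop) ^ 2) + 2 *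
          (αθ * dθ * (βθ * dθ') / (1 - lamA)) * ((((5 * (κ₂ ^ 4 * γop ^ 2) / (1 - lam * γop) ^ 2) + 1) / 2) + (5 * (κ₂ ^ 4 * γop ^ 2) / (1 - lam * γop) ^ 2)) + 24 * (((5 * (κ₂ ^ 4 * γop ^ 2) / (1 - lam * γop) ^ 2) + 1) / 2) *
          Real.sqrt ((αθ * dθ * (βθ * dθ') / (1 - lamA)) * (5 * (κ₂ ^ 4 * γop ^ 2) / (1 - lam * γop) ^ 2))) +
        (6 * (αθ * dθ * (βθ * dθ') / (1 - lamA)) + 5 * (50 * (κ₂ ^ 6 * γop ^ 3) / (1 - lam * γop) ^ 3) + ((((5 * (κ₂ ^ 4 * γop ^ 2) / (1 - lam * γop) ^ 2) + 1) / 2) + (5 * (κ₂ ^ 4 * γop ^ 2) / (1 - lam * γop) ^ 2)) ^ 2 / 2 + 3 *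
          (((5 * (κ₂ ^ 4 * γop ^ 2) / (1 - lam * γop) ^ 2) + 1) / 2) * (5 * (κ₂ ^ 4 * γop ^ 2) / (1 - lam * γop) ^ 2) + 3 * (αθ * dθ * (βθ * dθ') / (1 - lamA)) *
          ((((5 * (κ₂ ^ 4 * γop ^ 2) / (1 - lam * γop) ^ 2) + 1) / 2) + (5 * (κ₂ ^ 4 * γop ^ 2) / (1 - lam * γop) ^ 2)) + 12 * (((5 * (κ₂ ^ 4 * γop ^ 2) / (1 - lam * γop) ^ 2) + 1) / 2) * Real.sqrt
          ((αθ * dθ * (βθ * dθ') / (1 - lamA)) * (5 * (κ₂ ^ 4 * γop ^ 2) / (1 - lam * γop) ^ 2)))) ≤ C5) (hr₁1 : ∀ x y, 1 ≤ r₁ x y) (hr₁symm : ∀ x y, r₁ x y = r₁ y x) (hr₁mul : ∀ x y z, r₁ x z ≤ r₁ x y * r₁ y z)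
    (hr₁8 : ∀ x y, r₁ x y ^ 8 ≤ r x y) (hC40 : 0 ≤ C4) (hC50 : 0 ≤ C5) (hϑ1 : ∀ x y, 1 ≤ ϑ x y) (hϑsymm : ∀ x y, ϑ x y = ϑ y x) (hϑmul : ∀ x y z, ϑ x z ≤ ϑ x y * ϑ y z) (hϑ4 : ∀ x y, ϑ x y ^ 4 ≤ ϑ₂ x y)
    (hϑ₂symm : ∀ x y, ϑ₂ x y = ϑ₂ y x) (hϑσ6 : ∀ x y w, ϑ x y ^ 6 ≤ σ x w * σ y w) (hϑr₁ : ∀ x y, ϑ x y ≤ r₁ x y) (hG : ∀ a, ∑ b, ϑ a b ^ 6 / Real.sqrt (ρ a b) ≤ G) (hΘ : ∀ a, ∑ b, (ϑ a b ^ 4) ^ 2 / ϑ₂ a b ≤ Θ8)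
    (hS2 : ∀ a, ∑ b, ϑ a b ^ 2 / r₁ a b ≤ S2) (hhrw : ∀ v, ∑ u, ϑ₂ v u * Hk v u ≤ hrϑ) (hhc : ∀ a, ∑ b, ϑ₂ a b * Hk b a ≤ hcϑ) (hk3m : ∀ y, ∑ x, ∑ v, K3 x y v * (ϑ₂ y x * ϑ₂ y v * ϑ₂ x v) ≤ k3mϑ)
    (hk3c : ∀ v, ∑ y, ∑ z, K3 y z v * (ϑ₂ v y * ϑ₂ v z * ϑ₂ y z) ≤ k3cϑ) (hk5 : ∀ s, ∑ x, ∑ y, ∑ z, ∑ t, K5 y z t s x * (ϑ₂ x y * ϑ₂ x z * ϑ₂ x t * ϑ₂ x s * ϑ₂ y z * ϑ₂ y t * ϑ₂ y s * ϑ₂ z t * ϑ₂ z s * ϑ₂ t s) ≤ k5ϑ4)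
    (hσA0 : ∀ u z', 0 ≤ σA u z') (hσϑ₂ : ∀ v u z', σ v z' ≤ ϑ₂ v u * σA u z') (hAr : ∀ u, ∑ z', |A u z'| * σA u z' ≤ αrσ) (hAc : ∀ z', ∑ u, |A u z'| * σA u z' ≤ αcσ) (hαcσ0 : 0 ≤ αcσ)
        (hk3r : ∀ x, ∑ y, ∑ v, K3 x y v * (ϑ₂ x y * ϑ₂ x v * ϑ₂ y v) ≤ k3rϑ) (hk4y : ∀ y, ∑ x, ∑ z, ∑ t, K4 y z t x * (ϑ₂ x y * ϑ₂ x z * ϑ₂ x t * ϑ₂ y z * ϑ₂ y t * ϑ₂ z t) ≤ k4ϑ1)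
        (hk4t : ∀ t, ∑ x, ∑ y, ∑ z, K4 y z t x * (ϑ₂ x y * ϑ₂ x z * ϑ₂ x t * ϑ₂ y z * ϑ₂ y t * ϑ₂ z t) ≤ k4ϑ3) (hk4x : ∀ x, ∑ y, ∑ z, ∑ t, K4 y z t x * (ϑ₂ x y * ϑ₂ x z * ϑ₂ x t * ϑ₂ y z * ϑ₂ y t * ϑ₂ z t) ≤ k4ϑ4)
        (hk5x : ∀ x, ∑ y, ∑ z, ∑ t, ∑ s, K5 y z t s x * (ϑ₂ x y * ϑ₂ x z * ϑ₂ x t * ϑ₂ x s * ϑ₂ y z * ϑ₂ y t * ϑ₂ y s * ϑ₂ z t * ϑ₂ z s * ϑ₂ t s) ≤ k5ϑ5) (hαθ : hrϑ * αrσ ≤ αθ) (hαθ' : k3rϑ * αrσ ≤ αθ) (hαθ'' : k4ϑ1 * αrσ ≤ αθ)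
        (hαβ : αθ ≤ βθ) (hαθc : hcϑ * αcσ ≤ αθc) (hαg2m : k3mϑ * αrσ ≤ αg2m) (hαg1c : k3cϑ * αcσ ≤ αg1c) (hαk4m3 : k4ϑ3 * αrσ ≤ αk4m3) (hαk4c : k4ϑ4 * αcσ ≤ αk4c) (hαk5m4 : k5ϑ4 * αrσ ≤ αk5m4) (hαk5c : k5ϑ5 * αcσ ≤ αk5c) (s : ι) :
    ∑ x, ∑ y, ∑ z, ∑ t, |lineDeriv ℝ
        (fun ψ' : EuclideanSpace ℝ ι => (∫ ω : EuclideanSpace ℝ ι, exp (-U (ω + ψ')) ∂(multivariateGaussian 0 (A * Aᵀ)))⁻¹ *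
          (∫ ω : EuclideanSpace ℝ ι, exp (-U (ω + ψ')) * U₄ (ω + ψ') (EuclideanSpace.single y (1 : ℝ)) (EuclideanSpace.single z (1 : ℝ)) (EuclideanSpace.single t (1 : ℝ)) (EuclideanSpace.single s (1 : ℝ))
            ∂(multivariateGaussian 0 (A * Aᵀ))) -
          (((∫ ω : EuclideanSpace ℝ ι, exp (-U (ω + ψ')) ∂(multivariateGaussian 0 (A * Aᵀ)))⁻¹ *
              (∫ ω : EuclideanSpace ℝ ι, exp (-U (ω + ψ')) * (U₃ (ω + ψ') (EuclideanSpace.single y (1 : ℝ)) (EuclideanSpace.single t (1 : ℝ)) (EuclideanSpace.single s (1 : ℝ)) * U' (ω + ψ') (EuclideanSpace.single z (1 : ℝ)))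
                ∂(multivariateGaussian 0 (A * Aᵀ))) - ((∫ ω : EuclideanSpace ℝ ι, exp (-U (ω + ψ')) ∂(multivariateGaussian 0 (A * Aᵀ))) ^ 2)⁻¹ *
              ((∫ ω : EuclideanSpace ℝ ι, exp (-U (ω + ψ')) * U₃ (ω + ψ') (EuclideanSpace.single y (1 : ℝ)) (EuclideanSpace.single t (1 : ℝ)) (EuclideanSpace.single s (1 : ℝ)) ∂(multivariateGaussian 0 (A * Aᵀ))) *
                (∫ ω : EuclideanSpace ℝ ι, exp (-U (ω + ψ')) * U' (ω + ψ') (EuclideanSpace.single z (1 : ℝ)) ∂(multivariateGaussian 0 (A * Aᵀ))))) +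
            ((∫ ω : EuclideanSpace ℝ ι, exp (-U (ω + ψ')) ∂(multivariateGaussian 0 (A * Aᵀ)))⁻¹ *
              (∫ ω : EuclideanSpace ℝ ι, exp (-U (ω + ψ')) * (U₃ (ω + ψ') (EuclideanSpace.single y (1 : ℝ)) (EuclideanSpace.single z (1 : ℝ)) (EuclideanSpace.single s (1 : ℝ)) * U' (ω + ψ') (EuclideanSpace.single t (1 : ℝ)))
                ∂(multivariateGaussian 0 (A * Aᵀ))) - ((∫ ω : EuclideanSpace ℝ ι, exp (-U (ω + ψ')) ∂(multivariateGaussian 0 (A * Aᵀ))) ^ 2)⁻¹ *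
              ((∫ ω : EuclideanSpace ℝ ι, exp (-U (ω + ψ')) * U₃ (ω + ψ') (EuclideanSpace.single y (1 : ℝ)) (EuclideanSpace.single z (1 : ℝ)) (EuclideanSpace.single s (1 : ℝ)) ∂(multivariateGaussian 0 (A * Aᵀ))) *
                (∫ ω : EuclideanSpace ℝ ι, exp (-U (ω + ψ')) * U' (ω + ψ') (EuclideanSpace.single t (1 : ℝ)) ∂(multivariateGaussian 0 (A * Aᵀ))))) +
            ((∫ ω : EuclideanSpace ℝ ι, exp (-U (ω + ψ')) ∂(multivariateGaussian 0 (A * Aᵀ)))⁻¹ *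
              (∫ ω : EuclideanSpace ℝ ι, exp (-U (ω + ψ')) * (U₃ (ω + ψ') (EuclideanSpace.single y (1 : ℝ)) (EuclideanSpace.single z (1 : ℝ)) (EuclideanSpace.single t (1 : ℝ)) * U' (ω + ψ') (EuclideanSpace.single s (1 : ℝ)))
                ∂(multivariateGaussian 0 (A * Aᵀ))) - ((∫ ω : EuclideanSpace ℝ ι, exp (-U (ω + ψ')) ∂(multivariateGaussian 0 (A * Aᵀ))) ^ 2)⁻¹ *
              ((∫ ω : EuclideanSpace ℝ ι, exp (-U (ω + ψ')) * U₃ (ω + ψ') (EuclideanSpace.single y (1 : ℝ)) (EuclideanSpace.single z (1 : ℝ)) (EuclideanSpace.single t (1 : ℝ)) ∂(multivariateGaussian 0 (A * Aᵀ))) *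
                (∫ ω : EuclideanSpace ℝ ι, exp (-U (ω + ψ')) * U' (ω + ψ') (EuclideanSpace.single s (1 : ℝ)) ∂(multivariateGaussian 0 (A * Aᵀ))))) +
            ((∫ ω : EuclideanSpace ℝ ι, exp (-U (ω + ψ')) ∂(multivariateGaussian 0 (A * Aᵀ)))⁻¹ *
              (∫ ω : EuclideanSpace ℝ ι, exp (-U (ω + ψ')) * (U' (ω + ψ') (EuclideanSpace.single y (1 : ℝ)) * U₃ (ω + ψ') (EuclideanSpace.single z (1 : ℝ)) (EuclideanSpace.single t (1 : ℝ)) (EuclideanSpace.single s (1 : ℝ)))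
                ∂(multivariateGaussian 0 (A * Aᵀ))) - ((∫ ω : EuclideanSpace ℝ ι, exp (-U (ω + ψ')) ∂(multivariateGaussian 0 (A * Aᵀ))) ^ 2)⁻¹ *
              ((∫ ω : EuclideanSpace ℝ ι, exp (-U (ω + ψ')) * U' (ω + ψ') (EuclideanSpace.single y (1 : ℝ)) ∂(multivariateGaussian 0 (A * Aᵀ))) *
                (∫ ω : EuclideanSpace ℝ ι, exp (-U (ω + ψ')) * U₃ (ω + ψ') (EuclideanSpace.single z (1 : ℝ)) (EuclideanSpace.single t (1 : ℝ)) (EuclideanSpace.single s (1 : ℝ)) ∂(multivariateGaussian 0 (A * Aᵀ)))))) -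
          (((∫ ω : EuclideanSpace ℝ ι, exp (-U (ω + ψ')) ∂(multivariateGaussian 0 (A * Aᵀ)))⁻¹ *
              (∫ ω : EuclideanSpace ℝ ι, exp (-U (ω + ψ')) * (U'' (ω + ψ') (EuclideanSpace.single y (1 : ℝ)) (EuclideanSpace.single z (1 : ℝ)) * U'' (ω + ψ') (EuclideanSpace.single t (1 : ℝ)) (EuclideanSpace.single s (1 : ℝ)))
                ∂(multivariateGaussian 0 (A * Aᵀ))) - ((∫ ω : EuclideanSpace ℝ ι, exp (-U (ω + ψ')) ∂(multivariateGaussian 0 (A * Aᵀ))) ^ 2)⁻¹ *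
              ((∫ ω : EuclideanSpace ℝ ι, exp (-U (ω + ψ')) * U'' (ω + ψ') (EuclideanSpace.single y (1 : ℝ)) (EuclideanSpace.single z (1 : ℝ)) ∂(multivariateGaussian 0 (A * Aᵀ))) *
                (∫ ω : EuclideanSpace ℝ ι, exp (-U (ω + ψ')) * U'' (ω + ψ') (EuclideanSpace.single t (1 : ℝ)) (EuclideanSpace.single s (1 : ℝ)) ∂(multivariateGaussian 0 (A * Aᵀ))))) +
            ((∫ ω : EuclideanSpace ℝ ι, exp (-U (ω + ψ')) ∂(multivariateGaussian 0 (A * Aᵀ)))⁻¹ *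
              (∫ ω : EuclideanSpace ℝ ι, exp (-U (ω + ψ')) * (U'' (ω + ψ') (EuclideanSpace.single y (1 : ℝ)) (EuclideanSpace.single t (1 : ℝ)) * U'' (ω + ψ') (EuclideanSpace.single z (1 : ℝ)) (EuclideanSpace.single s (1 : ℝ)))
                ∂(multivariateGaussian 0 (A * Aᵀ))) - ((∫ ω : EuclideanSpace ℝ ι, exp (-U (ω + ψ')) ∂(multivariateGaussian 0 (A * Aᵀ))) ^ 2)⁻¹ *
              ((∫ ω : EuclideanSpace ℝ ι, exp (-U (ω + ψ')) * U'' (ω + ψ') (EuclideanSpace.single y (1 : ℝ)) (EuclideanSpace.single t (1 : ℝ)) ∂(multivariateGaussian 0 (A * Aᵀ))) *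
                (∫ ω : EuclideanSpace ℝ ι, exp (-U (ω + ψ')) * U'' (ω + ψ') (EuclideanSpace.single z (1 : ℝ)) (EuclideanSpace.single s (1 : ℝ)) ∂(multivariateGaussian 0 (A * Aᵀ))))) +
            ((∫ ω : EuclideanSpace ℝ ι, exp (-U (ω + ψ')) ∂(multivariateGaussian 0 (A * Aᵀ)))⁻¹ *
              (∫ ω : EuclideanSpace ℝ ι, exp (-U (ω + ψ')) * (U'' (ω + ψ') (EuclideanSpace.single y (1 : ℝ)) (EuclideanSpace.single s (1 : ℝ)) * U'' (ω + ψ') (EuclideanSpace.single z (1 : ℝ)) (EuclideanSpace.single t (1 : ℝ)))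
                ∂(multivariateGaussian 0 (A * Aᵀ))) - ((∫ ω : EuclideanSpace ℝ ι, exp (-U (ω + ψ')) ∂(multivariateGaussian 0 (A * Aᵀ))) ^ 2)⁻¹ *
              ((∫ ω : EuclideanSpace ℝ ι, exp (-U (ω + ψ')) * U'' (ω + ψ') (EuclideanSpace.single y (1 : ℝ)) (EuclideanSpace.single s (1 : ℝ)) ∂(multivariateGaussian 0 (A * Aᵀ))) *
                (∫ ω : EuclideanSpace ℝ ι, exp (-U (ω + ψ')) * U'' (ω + ψ') (EuclideanSpace.single z (1 : ℝ)) (EuclideanSpace.single t (1 : ℝ)) ∂(multivariateGaussian 0 (A * Aᵀ)))))) +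
          ((∫ ω : EuclideanSpace ℝ ι, exp (-U (ω + ψ')) ∂(multivariateGaussian 0 (A * Aᵀ)))⁻¹ *
            (∫ ω : EuclideanSpace ℝ ι, exp (-U (ω + ψ')) *
              ((U'' (ω + ψ') (EuclideanSpace.single y (1 : ℝ)) (EuclideanSpace.single z (1 : ℝ)) -
                  ((∫ ω : EuclideanSpace ℝ ι, exp (-U (ω + ψ')) ∂(multivariateGaussian 0 (A * Aᵀ)))⁻¹ *
                    (∫ ω : EuclideanSpace ℝ ι, exp (-U (ω + ψ')) * U'' (ω + ψ') (EuclideanSpace.single y (1 : ℝ)) (EuclideanSpace.single z (1 : ℝ)) ∂(multivariateGaussian 0 (A * Aᵀ))))) *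
                (U' (ω + ψ') (EuclideanSpace.single t (1 : ℝ)) -
                  ((∫ ω : EuclideanSpace ℝ ι, exp (-U (ω + ψ')) ∂(multivariateGaussian 0 (A * Aᵀ)))⁻¹ *
                    (∫ ω : EuclideanSpace ℝ ι, exp (-U (ω + ψ')) * U' (ω + ψ') (EuclideanSpace.single t (1 : ℝ)) ∂(multivariateGaussian 0 (A * Aᵀ))))) *
                (U' (ω + ψ') (EuclideanSpace.single s (1 : ℝ)) -
                  ((∫ ω : EuclideanSpace ℝ ι, exp (-U (ω + ψ')) ∂(multivariateGaussian 0 (A * Aᵀ)))⁻¹ *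
                    (∫ ω : EuclideanSpace ℝ ι, exp (-U (ω + ψ')) * U' (ω + ψ') (EuclideanSpace.single s (1 : ℝ)) ∂(multivariateGaussian 0 (A * Aᵀ)))))) ∂(multivariateGaussian 0 (A * Aᵀ))) +
            (∫ ω : EuclideanSpace ℝ ι, exp (-U (ω + ψ')) ∂(multivariateGaussian 0 (A * Aᵀ)))⁻¹ *
            (∫ ω : EuclideanSpace ℝ ι, exp (-U (ω + ψ')) *
              ((U'' (ω + ψ') (EuclideanSpace.single y (1 : ℝ)) (EuclideanSpace.single t (1 : ℝ)) -
                  ((∫ ω : EuclideanSpace ℝ ι, exp (-U (ω + ψ')) ∂(multivariateGaussian 0 (A * Aᵀ)))⁻¹ *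
                    (∫ ω : EuclideanSpace ℝ ι, exp (-U (ω + ψ')) * U'' (ω + ψ') (EuclideanSpace.single y (1 : ℝ)) (EuclideanSpace.single t (1 : ℝ)) ∂(multivariateGaussian 0 (A * Aᵀ))))) *
                (U' (ω + ψ') (EuclideanSpace.single z (1 : ℝ)) -
                  ((∫ ω : EuclideanSpace ℝ ι, exp (-U (ω + ψ')) ∂(multivariateGaussian 0 (A * Aᵀ)))⁻¹ *
                    (∫ ω : EuclideanSpace ℝ ι, exp (-U (ω + ψ')) * U' (ω + ψ') (EuclideanSpace.single z (1 : ℝ)) ∂(multivariateGaussian 0 (A * Aᵀ))))) *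
                (U' (ω + ψ') (EuclideanSpace.single s (1 : ℝ)) -
                  ((∫ ω : EuclideanSpace ℝ ι, exp (-U (ω + ψ')) ∂(multivariateGaussian 0 (A * Aᵀ)))⁻¹ *
                    (∫ ω : EuclideanSpace ℝ ι, exp (-U (ω + ψ')) * U' (ω + ψ') (EuclideanSpace.single s (1 : ℝ)) ∂(multivariateGaussian 0 (A * Aᵀ)))))) ∂(multivariateGaussian 0 (A * Aᵀ))) +
            (∫ ω : EuclideanSpace ℝ ι, exp (-U (ω + ψ')) ∂(multivariateGaussian 0 (A * Aᵀ)))⁻¹ *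
            (∫ ω : EuclideanSpace ℝ ι, exp (-U (ω + ψ')) *
              ((U'' (ω + ψ') (EuclideanSpace.single y (1 : ℝ)) (EuclideanSpace.single s (1 : ℝ)) -
                  ((∫ ω : EuclideanSpace ℝ ι, exp (-U (ω + ψ')) ∂(multivariateGaussian 0 (A * Aᵀ)))⁻¹ *
                    (∫ ω : EuclideanSpace ℝ ι, exp (-U (ω + ψ')) * U'' (ω + ψ') (EuclideanSpace.single y (1 : ℝ)) (EuclideanSpace.single s (1 : ℝ)) ∂(multivariateGaussian 0 (A * Aᵀ))))) *
                (U' (ω + ψ') (EuclideanSpace.single z (1 : ℝ)) -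
                  ((∫ ω : EuclideanSpace ℝ ι, exp (-U (ω + ψ')) ∂(multivariateGaussian 0 (A * Aᵀ)))⁻¹ *
                    (∫ ω : EuclideanSpace ℝ ι, exp (-U (ω + ψ')) * U' (ω + ψ') (EuclideanSpace.single z (1 : ℝ)) ∂(multivariateGaussian 0 (A * Aᵀ))))) *
                (U' (ω + ψ') (EuclideanSpace.single t (1 : ℝ)) -
                  ((∫ ω : EuclideanSpace ℝ ι, exp (-U (ω + ψ')) ∂(multivariateGaussian 0 (A * Aᵀ)))⁻¹ *
                    (∫ ω : EuclideanSpace ℝ ι, exp (-U (ω + ψ')) * U' (ω + ψ') (EuclideanSpace.single t (1 : ℝ)) ∂(multivariateGaussian 0 (A * Aᵀ)))))) ∂(multivariateGaussian 0 (A * Aᵀ))) +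
            (∫ ω : EuclideanSpace ℝ ι, exp (-U (ω + ψ')) ∂(multivariateGaussian 0 (A * Aᵀ)))⁻¹ *
            (∫ ω : EuclideanSpace ℝ ι, exp (-U (ω + ψ')) *
              ((U' (ω + ψ') (EuclideanSpace.single y (1 : ℝ)) -
                  ((∫ ω : EuclideanSpace ℝ ι, exp (-U (ω + ψ')) ∂(multivariateGaussian 0 (A * Aᵀ)))⁻¹ *
                    (∫ ω : EuclideanSpace ℝ ι, exp (-U (ω + ψ')) * U' (ω + ψ') (EuclideanSpace.single y (1 : ℝ)) ∂(multivariateGaussian 0 (A * Aᵀ))))) *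
                (U'' (ω + ψ') (EuclideanSpace.single z (1 : ℝ)) (EuclideanSpace.single t (1 : ℝ)) -
                  ((∫ ω : EuclideanSpace ℝ ι, exp (-U (ω + ψ')) ∂(multivariateGaussian 0 (A * Aᵀ)))⁻¹ *
                    (∫ ω : EuclideanSpace ℝ ι, exp (-U (ω + ψ')) * U'' (ω + ψ') (EuclideanSpace.single z (1 : ℝ)) (EuclideanSpace.single t (1 : ℝ)) ∂(multivariateGaussian 0 (A * Aᵀ))))) *
                (U' (ω + ψ') (EuclideanSpace.single s (1 : ℝ)) -
                  ((∫ ω : EuclideanSpace ℝ ι, exp (-U (ω + ψ')) ∂(multivariateGaussian 0 (A * Aᵀ)))⁻¹ *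
                    (∫ ω : EuclideanSpace ℝ ι, exp (-U (ω + ψ')) * U' (ω + ψ') (EuclideanSpace.single s (1 : ℝ)) ∂(multivariateGaussian 0 (A * Aᵀ)))))) ∂(multivariateGaussian 0 (A * Aᵀ))) +
            (∫ ω : EuclideanSpace ℝ ι, exp (-U (ω + ψ')) ∂(multivariateGaussian 0 (A * Aᵀ)))⁻¹ *
            (∫ ω : EuclideanSpace ℝ ι, exp (-U (ω + ψ')) *
              ((U' (ω + ψ') (EuclideanSpace.single y (1 : ℝ)) -
                  ((∫ ω : EuclideanSpace ℝ ι, exp (-U (ω + ψ')) ∂(multivariateGaussian 0 (A * Aᵀ)))⁻¹ *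
                    (∫ ω : EuclideanSpace ℝ ι, exp (-U (ω + ψ')) * U' (ω + ψ') (EuclideanSpace.single y (1 : ℝ)) ∂(multivariateGaussian 0 (A * Aᵀ))))) *
                (U'' (ω + ψ') (EuclideanSpace.single z (1 : ℝ)) (EuclideanSpace.single s (1 : ℝ)) -
                  ((∫ ω : EuclideanSpace ℝ ι, exp (-U (ω + ψ')) ∂(multivariateGaussian 0 (A * Aᵀ)))⁻¹ *
                    (∫ ω : EuclideanSpace ℝ ι, exp (-U (ω + ψ')) * U'' (ω + ψ') (EuclideanSpace.single z (1 : ℝ)) (EuclideanSpace.single s (1 : ℝ)) ∂(multivariateGaussian 0 (A * Aᵀ))))) *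
                (U' (ω + ψ') (EuclideanSpace.single t (1 : ℝ)) -
                  ((∫ ω : EuclideanSpace ℝ ι, exp (-U (ω + ψ')) ∂(multivariateGaussian 0 (A * Aᵀ)))⁻¹ *
                    (∫ ω : EuclideanSpace ℝ ι, exp (-U (ω + ψ')) * U' (ω + ψ') (EuclideanSpace.single t (1 : ℝ)) ∂(multivariateGaussian 0 (A * Aᵀ)))))) ∂(multivariateGaussian 0 (A * Aᵀ))) +
            (∫ ω : EuclideanSpace ℝ ι, exp (-U (ω + ψ')) ∂(multivariateGaussian 0 (A * Aᵀ)))⁻¹ *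
            (∫ ω : EuclideanSpace ℝ ι, exp (-U (ω + ψ')) *
              ((U' (ω + ψ') (EuclideanSpace.single y (1 : ℝ)) -
                  ((∫ ω : EuclideanSpace ℝ ι, exp (-U (ω + ψ')) ∂(multivariateGaussian 0 (A * Aᵀ)))⁻¹ *
                    (∫ ω : EuclideanSpace ℝ ι, exp (-U (ω + ψ')) * U' (ω + ψ') (EuclideanSpace.single y (1 : ℝ)) ∂(multivariateGaussian 0 (A * Aᵀ))))) *
                (U'' (ω + ψ') (EuclideanSpace.single t (1 : ℝ)) (EuclideanSpace.single s (1 : ℝ)) -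
                  ((∫ ω : EuclideanSpace ℝ ι, exp (-U (ω + ψ')) ∂(multivariateGaussian 0 (A * Aᵀ)))⁻¹ *
                    (∫ ω : EuclideanSpace ℝ ι, exp (-U (ω + ψ')) * U'' (ω + ψ') (EuclideanSpace.single t (1 : ℝ)) (EuclideanSpace.single s (1 : ℝ)) ∂(multivariateGaussian 0 (A * Aᵀ))))) *
                (U' (ω + ψ') (EuclideanSpace.single z (1 : ℝ)) -
                  ((∫ ω : EuclideanSpace ℝ ι, exp (-U (ω + ψ')) ∂(multivariateGaussian 0 (A * Aᵀ)))⁻¹ *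
                    (∫ ω : EuclideanSpace ℝ ι, exp (-U (ω + ψ')) * U' (ω + ψ') (EuclideanSpace.single z (1 : ℝ)) ∂(multivariateGaussian 0 (A * Aᵀ)))))) ∂(multivariateGaussian 0 (A * Aᵀ)))) -
          ((∫ ω : EuclideanSpace ℝ ι, exp (-U (ω + ψ')) ∂(multivariateGaussian 0 (A * Aᵀ)))⁻¹ *
            (∫ ω : EuclideanSpace ℝ ι, exp (-U (ω + ψ')) *
              ((U' (ω + ψ') (EuclideanSpace.single y (1 : ℝ)) -
                  ((∫ ω : EuclideanSpace ℝ ι, exp (-U (ω + ψ')) ∂(multivariateGaussian 0 (A * Aᵀ)))⁻¹ *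
                    (∫ ω : EuclideanSpace ℝ ι, exp (-U (ω + ψ')) * U' (ω + ψ') (EuclideanSpace.single y (1 : ℝ)) ∂(multivariateGaussian 0 (A * Aᵀ))))) *
                (U' (ω + ψ') (EuclideanSpace.single z (1 : ℝ)) -
                  ((∫ ω : EuclideanSpace ℝ ι, exp (-U (ω + ψ')) ∂(multivariateGaussian 0 (A * Aᵀ)))⁻¹ *
                    (∫ ω : EuclideanSpace ℝ ι, exp (-U (ω + ψ')) * U' (ω + ψ') (EuclideanSpace.single z (1 : ℝ)) ∂(multivariateGaussian 0 (A * Aᵀ))))) *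
                (U' (ω + ψ') (EuclideanSpace.single t (1 : ℝ)) -
                  ((∫ ω : EuclideanSpace ℝ ι, exp (-U (ω + ψ')) ∂(multivariateGaussian 0 (A * Aᵀ)))⁻¹ *
                    (∫ ω : EuclideanSpace ℝ ι, exp (-U (ω + ψ')) * U' (ω + ψ') (EuclideanSpace.single t (1 : ℝ)) ∂(multivariateGaussian 0 (A * Aᵀ))))) *
                (U' (ω + ψ') (EuclideanSpace.single s (1 : ℝ)) -
                  ((∫ ω : EuclideanSpace ℝ ι, exp (-U (ω + ψ')) ∂(multivariateGaussian 0 (A * Aᵀ)))⁻¹ *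
                    (∫ ω : EuclideanSpace ℝ ι, exp (-U (ω + ψ')) * U' (ω + ψ') (EuclideanSpace.single s (1 : ℝ)) ∂(multivariateGaussian 0 (A * Aᵀ)))))) ∂(multivariateGaussian 0 (A * Aᵀ))) -
            ((∫ ω : EuclideanSpace ℝ ι, exp (-U (ω + ψ')) ∂(multivariateGaussian 0 (A * Aᵀ)))⁻¹ *
              (∫ ω : EuclideanSpace ℝ ι, exp (-U (ω + ψ')) *
                ((U' (ω + ψ') (EuclideanSpace.single y (1 : ℝ)) -
                    ((∫ ω : EuclideanSpace ℝ ι, exp (-U (ω + ψ')) ∂(multivariateGaussian 0 (A * Aᵀ)))⁻¹ *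
                      (∫ ω : EuclideanSpace ℝ ι, exp (-U (ω + ψ')) * U' (ω + ψ') (EuclideanSpace.single y (1 : ℝ)) ∂(multivariateGaussian 0 (A * Aᵀ))))) *
                  (U' (ω + ψ') (EuclideanSpace.single z (1 : ℝ)) -
                    ((∫ ω : EuclideanSpace ℝ ι, exp (-U (ω + ψ')) ∂(multivariateGaussian 0 (A * Aᵀ)))⁻¹ *
                      (∫ ω : EuclideanSpace ℝ ι, exp (-U (ω + ψ')) * U' (ω + ψ') (EuclideanSpace.single z (1 : ℝ)) ∂(multivariateGaussian 0 (A * Aᵀ)))))) ∂(multivariateGaussian 0 (A * Aᵀ)))) *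
            ((∫ ω : EuclideanSpace ℝ ι, exp (-U (ω + ψ')) ∂(multivariateGaussian 0 (A * Aᵀ)))⁻¹ *
              (∫ ω : EuclideanSpace ℝ ι, exp (-U (ω + ψ')) *
                ((U' (ω + ψ') (EuclideanSpace.single t (1 : ℝ)) -
                    ((∫ ω : EuclideanSpace ℝ ι, exp (-U (ω + ψ')) ∂(multivariateGaussian 0 (A * Aᵀ)))⁻¹ *
                      (∫ ω : EuclideanSpace ℝ ι, exp (-U (ω + ψ')) * U' (ω + ψ') (EuclideanSpace.single t (1 : ℝ)) ∂(multivariateGaussian 0 (A * Aᵀ))))) *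
                  (U' (ω + ψ') (EuclideanSpace.single s (1 : ℝ)) -
                    ((∫ ω : EuclideanSpace ℝ ι, exp (-U (ω + ψ')) ∂(multivariateGaussian 0 (A * Aᵀ)))⁻¹ *
                      (∫ ω : EuclideanSpace ℝ ι, exp (-U (ω + ψ')) * U' (ω + ψ') (EuclideanSpace.single s (1 : ℝ)) ∂(multivariateGaussian 0 (A * Aᵀ)))))) ∂(multivariateGaussian 0 (A * Aᵀ)))) -
            ((∫ ω : EuclideanSpace ℝ ι, exp (-U (ω + ψ')) ∂(multivariateGaussian 0 (A * Aᵀ)))⁻¹ *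
              (∫ ω : EuclideanSpace ℝ ι, exp (-U (ω + ψ')) *
                ((U' (ω + ψ') (EuclideanSpace.single y (1 : ℝ)) -
                    ((∫ ω : EuclideanSpace ℝ ι, exp (-U (ω + ψ')) ∂(multivariateGaussian 0 (A * Aᵀ)))⁻¹ *
                      (∫ ω : EuclideanSpace ℝ ι, exp (-U (ω + ψ')) * U' (ω + ψ') (EuclideanSpace.single y (1 : ℝ)) ∂(multivariateGaussian 0 (A * Aᵀ))))) *
                  (U' (ω + ψ') (EuclideanSpace.single t (1 : ℝ)) -
                    ((∫ ω : EuclideanSpace ℝ ι, exp (-U (ω + ψ')) ∂(multivariateGaussian 0 (A * Aᵀ)))⁻¹ *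
                      (∫ ω : EuclideanSpace ℝ ι, exp (-U (ω + ψ')) * U' (ω + ψ') (EuclideanSpace.single t (1 : ℝ)) ∂(multivariateGaussian 0 (A * Aᵀ)))))) ∂(multivariateGaussian 0 (A * Aᵀ)))) *
            ((∫ ω : EuclideanSpace ℝ ι, exp (-U (ω + ψ')) ∂(multivariateGaussian 0 (A * Aᵀ)))⁻¹ *
              (∫ ω : EuclideanSpace ℝ ι, exp (-U (ω + ψ')) *
                ((U' (ω + ψ') (EuclideanSpace.single z (1 : ℝ)) -
                    ((∫ ω : EuclideanSpace ℝ ι, exp (-U (ω + ψ')) ∂(multivariateGaussian 0 (A * Aᵀ)))⁻¹ *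
                      (∫ ω : EuclideanSpace ℝ ι, exp (-U (ω + ψ')) * U' (ω + ψ') (EuclideanSpace.single z (1 : ℝ)) ∂(multivariateGaussian 0 (A * Aᵀ))))) *
                  (U' (ω + ψ') (EuclideanSpace.single s (1 : ℝ)) -
                    ((∫ ω : EuclideanSpace ℝ ι, exp (-U (ω + ψ')) ∂(multivariateGaussian 0 (A * Aᵀ)))⁻¹ *
                      (∫ ω : EuclideanSpace ℝ ι, exp (-U (ω + ψ')) * U' (ω + ψ') (EuclideanSpace.single s (1 : ℝ)) ∂(multivariateGaussian 0 (A * Aᵀ)))))) ∂(multivariateGaussian 0 (A * Aᵀ)))) -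
            ((∫ ω : EuclideanSpace ℝ ι, exp (-U (ω + ψ')) ∂(multivariateGaussian 0 (A * Aᵀ)))⁻¹ *
              (∫ ω : EuclideanSpace ℝ ι, exp (-U (ω + ψ')) *
                ((U' (ω + ψ') (EuclideanSpace.single y (1 : ℝ)) -
                    ((∫ ω : EuclideanSpace ℝ ι, exp (-U (ω + ψ')) ∂(multivariateGaussian 0 (A * Aᵀ)))⁻¹ *
                      (∫ ω : EuclideanSpace ℝ ι, exp (-U (ω + ψ')) * U' (ω + ψ') (EuclideanSpace.single y (1 : ℝ)) ∂(multivariateGaussian 0 (A * Aᵀ))))) *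
                  (U' (ω + ψ') (EuclideanSpace.single s (1 : ℝ)) -
                    ((∫ ω : EuclideanSpace ℝ ι, exp (-U (ω + ψ')) ∂(multivariateGaussian 0 (A * Aᵀ)))⁻¹ *
                      (∫ ω : EuclideanSpace ℝ ι, exp (-U (ω + ψ')) * U' (ω + ψ') (EuclideanSpace.single s (1 : ℝ)) ∂(multivariateGaussian 0 (A * Aᵀ)))))) ∂(multivariateGaussian 0 (A * Aᵀ)))) *
            ((∫ ω : EuclideanSpace ℝ ι, exp (-U (ω + ψ')) ∂(multivariateGaussian 0 (A * Aᵀ)))⁻¹ *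
              (∫ ω : EuclideanSpace ℝ ι, exp (-U (ω + ψ')) *
                ((U' (ω + ψ') (EuclideanSpace.single z (1 : ℝ)) -
                    ((∫ ω : EuclideanSpace ℝ ι, exp (-U (ω + ψ')) ∂(multivariateGaussian 0 (A * Aᵀ)))⁻¹ *
                      (∫ ω : EuclideanSpace ℝ ι, exp (-U (ω + ψ')) * U' (ω + ψ') (EuclideanSpace.single z (1 : ℝ)) ∂(multivariateGaussian 0 (A * Aᵀ))))) *
                  (U' (ω + ψ') (EuclideanSpace.single t (1 : ℝ)) -
                    ((∫ ω : EuclideanSpace ℝ ι, exp (-U (ω + ψ')) ∂(multivariateGaussian 0 (A * Aᵀ)))⁻¹ *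
                      (∫ ω : EuclideanSpace ℝ ι, exp (-U (ω + ψ')) * U' (ω + ψ') (EuclideanSpace.single t (1 : ℝ)) ∂(multivariateGaussian 0 (A * Aᵀ)))))) ∂(multivariateGaussian 0 (A * Aᵀ)))))) ψ (EuclideanSpace.single x (1 : ℝ))|
        * (ϑ x y * ϑ x z * ϑ x t * ϑ x s * ϑ y z * ϑ y t * ϑ y s * ϑ z t * ϑ z s * ϑ t s) ≤
        (k5ϑ4 + dθ * αk5m4 * (dθ' * αθc) / (1 - lamA) + dθ * αk5m4 * (dθ' * αθc) / (1 - lamA) + dθ * αk4m3 * (dθ' * αg1c) / (1 - lamA) + Real.sqrt (2 * Real.sqrt (5 * (κ₂ ^ 4 * γop ^ 2) / (1 - lam * γop) ^ 2) * C3k) *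
          (Real.sqrt (k3mϑ * (Θ8 * Θ8)) * (G * G)) + dθ * αk5m4 * (dθ' * αθc) / (1 - lamA) + dθ * αk4m3 * (dθ' * αg1c) / (1 - lamA) + Real.sqrt (2 * Real.sqrt (5 * (κ₂ ^ 4 * γop ^ 2) / (1 - lam * γop) ^ 2) * C3k) *
          (Real.sqrt (k3mϑ * (Θ8 * Θ8)) * (G * G)) + dθ * αθ * (dθ' * αk5c) / (1 - lamA)) +
        (dθ * αg2m * (dθ' * αk4c) / (1 - lamA) + Real.sqrt (2 * Real.sqrt (5 * (κ₂ ^ 4 * γop ^ 2) / (1 - lam * γop) ^ 2) * C3k) * (G * (G * Real.sqrt (k3cϑ * (Θ8 * Θ8)))) + dθ * αk4m3 * (dθ' * αg1c) / (1 - lamA) + dθ * αk5m4 *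
          (dθ' * αθc) / (1 - lamA) + Real.sqrt (2 * Real.sqrt (5 * (κ₂ ^ 4 * γop ^ 2) / (1 - lam * γop) ^ 2) * C3k) * (Real.sqrt (k3mϑ * (Θ8 * Θ8)) * (G * G)) + dθ * αg2m * (dθ' * αk4c) / (1 - lamA) + dθ * αk4m3 * (dθ' * αg1c) /
          (1 - lamA) + Real.sqrt (4 * Real.sqrt (Real.sqrt (5 * (κ₂ ^ 4 * γop ^ 2) / (1 - lam * γop) ^ 2)) * C3h) * (Real.sqrt (hrϑ * Θ8) * (G * (G * Real.sqrt (hcϑ * Θ8))))) +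
        (dθ * αg2m * (dθ' * αk4c) / (1 - lamA) + dθ * αk4m3 * (dθ' * αg1c) / (1 - lamA) + Real.sqrt (4 * Real.sqrt (Real.sqrt (5 * (κ₂ ^ 4 * γop ^ 2) / (1 - lam * γop) ^ 2)) * C3h) *
          (Real.sqrt (hrϑ * Θ8) * (G * (G * Real.sqrt (hcϑ * Θ8)))) + dθ * αk4m3 * (dθ' * αg1c) / (1 - lamA) + dθ * αg2m * (dθ' * αk4c) / (1 - lamA) + Real.sqrt
          (4 * Real.sqrt (Real.sqrt (5 * (κ₂ ^ 4 * γop ^ 2) / (1 - lam * γop) ^ 2)) * C3h) * (Real.sqrt (hrϑ * Θ8) * (G * (G * Real.sqrt (hcϑ * Θ8)))) + Real.sqrt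
          (2 * Real.sqrt (5 * (κ₂ ^ 4 * γop ^ 2) / (1 - lam * γop) ^ 2) * C3k) * (G * (G * Real.sqrt (k3cϑ * (Θ8 * Θ8)))) + Real.sqrt (4 * Real.sqrt (Real.sqrt (5 * (κ₂ ^ 4 * γop ^ 2) / (1 - lam * γop) ^ 2)) * C3h) *
          (G * (G * (Real.sqrt (hcϑ * Θ8) * Real.sqrt (hcϑ * Θ8))))) +
        (Real.sqrt (4 * Real.sqrt (Real.sqrt (5 * (κ₂ ^ 4 * γop ^ 2) / (1 - lam * γop) ^ 2)) * C3h) * (Real.sqrt (hrϑ * Θ8) * (G * (G * Real.sqrt (hcϑ * Θ8)))) + Real.sqrt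
          (16 * (8 * (Real.sqrt (5 * (κ₂ ^ 4 * γop ^ 2) / (1 - lam * γop) ^ 2) * Real.sqrt (Real.sqrt (5 * (κ₂ ^ 4 * γop ^ 2) / (1 - lam * γop) ^ 2))) * C4)) * (S2 * (S2 * (Real.sqrt (hcϑ * Θ8) * S2))) + Real.sqrt
          (2 * Real.sqrt (5 * (κ₂ ^ 4 * γop ^ 2) / (1 - lam * γop) ^ 2) * C3k) * (G * (G * Real.sqrt (k3cϑ * (Θ8 * Θ8)))) + Real.sqrt (4 * Real.sqrt (Real.sqrt (5 * (κ₂ ^ 4 * γop ^ 2) / (1 - lam * γop) ^ 2)) * C3h) *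
          (G * (G * (Real.sqrt (hcϑ * Θ8) * Real.sqrt (hcϑ * Θ8)))) + Real.sqrt (4 * Real.sqrt (Real.sqrt (5 * (κ₂ ^ 4 * γop ^ 2) / (1 - lam * γop) ^ 2)) * C3h) * (Real.sqrt (hrϑ * Θ8) * (G * (G * Real.sqrt (hcϑ * Θ8)))) +
          Real.sqrt (16 * (8 * (Real.sqrt (5 * (κ₂ ^ 4 * γop ^ 2) / (1 - lam * γop) ^ 2) * Real.sqrt (Real.sqrt (5 * (κ₂ ^ 4 * γop ^ 2) / (1 - lam * γop) ^ 2))) * C4)) * (S2 * (S2 * (S2 * Real.sqrt (hcϑ * Θ8)))) + Real.sqrt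
          (2 * Real.sqrt (5 * (κ₂ ^ 4 * γop ^ 2) / (1 - lam * γop) ^ 2) * C3k) * (Real.sqrt (k3mϑ * (Θ8 * Θ8)) * (G * G))) +
        (Real.sqrt (4 * Real.sqrt (Real.sqrt (5 * (κ₂ ^ 4 * γop ^ 2) / (1 - lam * γop) ^ 2)) * C3h) * (Real.sqrt (hrϑ * Θ8) * (G * (Real.sqrt (hcϑ * Θ8) * G))) + Real.sqrt
          (4 * Real.sqrt (Real.sqrt (5 * (κ₂ ^ 4 * γop ^ 2) / (1 - lam * γop) ^ 2)) * C3h) * (Real.sqrt (hrϑ * Θ8) * (G * (G * Real.sqrt (hcϑ * Θ8)))) + Real.sqrt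
          (16 * (8 * (Real.sqrt (5 * (κ₂ ^ 4 * γop ^ 2) / (1 - lam * γop) ^ 2) * Real.sqrt (Real.sqrt (5 * (κ₂ ^ 4 * γop ^ 2) / (1 - lam * γop) ^ 2))) * C4)) * (Real.sqrt (hrϑ * Θ8) * (S2 * (S2 * S2))) + Real.sqrt
          (4 * Real.sqrt (Real.sqrt (5 * (κ₂ ^ 4 * γop ^ 2) / (1 - lam * γop) ^ 2)) * C3h) * (G * (Real.sqrt (hcϑ * Θ8) * (G * Real.sqrt (hcϑ * Θ8)))) + Real.sqrt
          (2 * Real.sqrt (5 * (κ₂ ^ 4 * γop ^ 2) / (1 - lam * γop) ^ 2) * C3k) * (G * (G * Real.sqrt (k3cϑ * (Θ8 * Θ8)))) + Real.sqrt (4 * Real.sqrt (Real.sqrt (5 * (κ₂ ^ 4 * γop ^ 2) / (1 - lam * γop) ^ 2)) * C3h) *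
          (Real.sqrt (hrϑ * Θ8) * (G * (G * Real.sqrt (hcϑ * Θ8)))) + Real.sqrt (16 * (8 * (Real.sqrt (5 * (κ₂ ^ 4 * γop ^ 2) / (1 - lam * γop) ^ 2) * Real.sqrt (Real.sqrt (5 * (κ₂ ^ 4 * γop ^ 2) / (1 - lam * γop) ^ 2))) * C4)) *
          (S2 * (S2 * (S2 * Real.sqrt (hcϑ * Θ8))))) +
        (Real.sqrt (4 * Real.sqrt (Real.sqrt (5 * (κ₂ ^ 4 * γop ^ 2) / (1 - lam * γop) ^ 2)) * C3h) * (Real.sqrt (hrϑ * Θ8) * (G * (Real.sqrt (hcϑ * Θ8) * G))) + Real.sqrt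
          (2 * Real.sqrt (5 * (κ₂ ^ 4 * γop ^ 2) / (1 - lam * γop) ^ 2) * C3k) * (Real.sqrt (k3mϑ * (Θ8 * Θ8)) * (G * G)) + Real.sqrt (4 * Real.sqrt (Real.sqrt (5 * (κ₂ ^ 4 * γop ^ 2) / (1 - lam * γop) ^ 2)) * C3h) *
          (Real.sqrt (hrϑ * Θ8) * (G * (G * Real.sqrt (hcϑ * Θ8)))) + Real.sqrt (16 * (8 * (Real.sqrt (5 * (κ₂ ^ 4 * γop ^ 2) / (1 - lam * γop) ^ 2) * Real.sqrt (Real.sqrt (5 * (κ₂ ^ 4 * γop ^ 2) / (1 - lam * γop) ^ 2))) * C4)) *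
          (Real.sqrt (hrϑ * Θ8) * (S2 * (S2 * S2))) + Real.sqrt (4 * Real.sqrt (Real.sqrt (5 * (κ₂ ^ 4 * γop ^ 2) / (1 - lam * γop) ^ 2)) * C3h) * (Real.sqrt (hrϑ * Θ8) * (G * (Real.sqrt (hcϑ * Θ8) * G))) + Real.sqrt
          (2 * Real.sqrt (5 * (κ₂ ^ 4 * γop ^ 2) / (1 - lam * γop) ^ 2) * C3k) * (Real.sqrt (k3mϑ * (Θ8 * Θ8)) * (G * G)) + Real.sqrt (4 * Real.sqrt (Real.sqrt (5 * (κ₂ ^ 4 * γop ^ 2) / (1 - lam * γop) ^ 2)) * C3h) *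
          (Real.sqrt (hrϑ * Θ8) * (G * (G * Real.sqrt (hcϑ * Θ8))))) +
        (Real.sqrt (16 * (8 * (Real.sqrt (5 * (κ₂ ^ 4 * γop ^ 2) / (1 - lam * γop) ^ 2) * Real.sqrt (Real.sqrt (5 * (κ₂ ^ 4 * γop ^ 2) / (1 - lam * γop) ^ 2))) * C4)) * (Real.sqrt (hrϑ * Θ8) * (S2 * (S2 * S2))) + Real.sqrt
          (16 * (8 * (Real.sqrt (5 * (κ₂ ^ 4 * γop ^ 2) / (1 - lam * γop) ^ 2) * Real.sqrt (Real.sqrt (5 * (κ₂ ^ 4 * γop ^ 2) / (1 - lam * γop) ^ 2))) * C4)) * (S2 * (Real.sqrt (hcϑ * Θ8) * (S2 * S2))) + Real.sqrt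
          (16 * (8 * (Real.sqrt (5 * (κ₂ ^ 4 * γop ^ 2) / (1 - lam * γop) ^ 2) * Real.sqrt (Real.sqrt (5 * (κ₂ ^ 4 * γop ^ 2) / (1 - lam * γop) ^ 2))) * C4)) * (S2 * (S2 * (Real.sqrt (hcϑ * Θ8) * S2))) + Real.sqrt
          (16 * (8 * (Real.sqrt (5 * (κ₂ ^ 4 * γop ^ 2) / (1 - lam * γop) ^ 2) * Real.sqrt (Real.sqrt (5 * (κ₂ ^ 4 * γop ^ 2) / (1 - lam * γop) ^ 2))) * C4)) * (S2 * (S2 * (S2 * Real.sqrt (hcϑ * Θ8)))) + Real.sqrt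
          (16 * (8 * (Real.sqrt (5 * (κ₂ ^ 4 * γop ^ 2) / (1 - lam * γop) ^ 2) * Real.sqrt (Real.sqrt (5 * (κ₂ ^ 4 * γop ^ 2) / (1 - lam * γop) ^ 2))) * C4)) * (Real.sqrt (hrϑ * Θ8) * (S2 * (S2 * S2)))) +
        (C5 * (S2 * (S2 * (S2 * S2)))) := by
  have hϑ₂1 : ∀ i j, 1 ≤ ϑ₂ i j := fun i j => ((hϑ1 i j).trans (le_self_pow₀ (hϑ1 i j) (by norm_num))).trans (hϑ4 i j)
  have hϑ₂0 : ∀ i j, 0 ≤ ϑ₂ i j := fun i j => zero_le_one.trans (hϑ₂1 i j)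
  have hK50 : ∀ i j k l u, 0 ≤ K5 i j k l u := fun i j k l u => (abs_nonneg _).trans (hK5 0 u i j k l)
  have hαrσ0 : 0 ≤ αrσ := (sum_nonneg fun z' _ => mul_nonneg (abs_nonneg _) (hσA0 s z')).trans (hAr s)
  have hhr0 : 0 ≤ hrϑ := letter_nonneg₁ (fun j => mul_nonneg (hϑ₂0 s j) (hHk0 s j)) (hhrw s)
  have hhc0 : 0 ≤ hcϑ := letter_nonneg₁ (fun j => mul_nonneg (hϑ₂0 s j) (hHk0 j s)) (hhc s)
  have hk3c0 : 0 ≤ k3cϑ := letter_nonneg₂ (fun i j => mul_nonneg (hK30 i j s) (mul_nonneg (mul_nonneg (hϑ₂0 s i) (hϑ₂0 s j)) (hϑ₂0 i j))) (hk3c s)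
  have hk4x0 : 0 ≤ k4ϑ4 := letter_nonneg₃ (fun i j k => mul_nonneg (hK40 i j k s) (mul_nonneg (mul_nonneg (mul_nonneg (mul_nonneg (mul_nonneg (hϑ₂0 s i) (hϑ₂0 s j)) (hϑ₂0 s k)) (hϑ₂0 i j)) (hϑ₂0 i k)) (hϑ₂0 j k))) (hk4x s)
  have hk5x0 : 0 ≤ k5ϑ5 := letter_nonneg₄
      (fun i j k l => mul_nonneg (hK50 i j k l s)
        (mul_nonneg (mul_nonneg (mul_nonneg (mul_nonneg (mul_nonneg (mul_nonneg (mul_nonneg (mul_nonneg (mul_nonneg (hϑ₂0 s i) (hϑ₂0 s j)) (hϑ₂0 s k)) (hϑ₂0 s l)) (hϑ₂0 i j)) (hϑ₂0 i k)) (hϑ₂0 i l)) (hϑ₂0 j k)) (hϑ₂0 j l))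
          (hϑ₂0 k l))) (hk5x s)
  have haσX : ∀ v : ι, ∑ w, (∑ u, |A u w| * Hk v u) * σ v w ≤ αθ := fun p => (hk_profile_row hHk0 hϑ₂0 hσϑ₂ hAr hαrσ0 (hk_row_of_slot hhrw) p).trans hαθ
  have haσ'X : ∀ (v : ι) (w : κ), (∑ u, |A u w| * Hk v u) * σ v w ≤ βθ := fun p q => (hk_profile_point hHk0 hσ0 haσX p q).trans hαβ
  have hβX : 0 ≤ βθ := ((mul_nonneg hhr0 hαrσ0).trans hαθ).trans hαβ
  have hgσX : ∀ p q : ι, ∑ w, (∑ u, |A u w| * K3 p q u) * σ p w ≤ αθ := fun p q => (k3_profile_row hK30 hϑ₂1 hσϑ₂ hAr hαrσ0 hk3r p q).trans hαθ'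
  have hgσ'X : ∀ (p q : ι) (w : κ), (∑ u, |A u w| * K3 p q u) * σ p w ≤ βθ := fun p q o => (k3_profile_point hK30 hσ0 hgσX p q o).trans hαβ
  have hkσX : ∀ p q o : ι, ∑ w, (∑ u, |A u w| * K4 p q o u) * σ p w ≤ αθ := fun p q o => (k4_profile_row hK40 hϑ₂1 hϑ₂symm hσϑ₂ hAr hαrσ0 hk4y p q o).trans hαθ''
  have hkσ'X : ∀ (p q o : ι) (w : κ), (∑ u, |A u w| * K4 p q o u) * σ p w ≤ βθ := fun p q o w => (k4_profile_point hK40 hσ0 hkσX p q o w).trans hαβ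
  have hbσcX : ∀ z', ∑ v, (∑ u, |A u z'| * Hk v u) * σ v z' ≤ αθc := fun p => (hk_profile_col hHk0 hσA0 hσϑ₂ hAc (hk_col_of_slot hϑ₂symm hhc) hhc0 p).trans hαθc
  have hαθcX : 0 ≤ αθc := (mul_nonneg hhc0 hαcσ0).trans hαθc
  have hg2mX : ∀ y, ∑ x, ϑ₂ y x * ∑ z', (∑ u, |A u z'| * K3 x y u) * σ y z' ≤ αg2m := fun p => (k3_mass_second hK30 hϑ₂1 hσA0 hσϑ₂ hAr hαrσ0 hk3m p).trans hαg2m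
  have hg1cX : ∀ z', ∑ x, ∑ y, (∑ u, |A u z'| * K3 x y u) * (σ x z' * ϑ₂ x y) ≤ αg1c := fun p => (k3_col_internal hK30 hϑ₂1 hϑ₂symm hσA0 hσϑ₂ hAc hk3c hk3c0 p).trans hαg1c
  have hαg1cX : 0 ≤ αg1c := (mul_nonneg hk3c0 hαcσ0).trans hαg1c
  have hk4m3X : ∀ s, ∑ p, ∑ q, (ϑ₂ s p * ϑ₂ s q * ϑ₂ p q) * ∑ z', (∑ u, |A u z'| * K4 p q s u) * σ s z' ≤ αk4m3 := fun p => (k4_mass_3 hK40 hϑ₂1 hσA0 hσϑ₂ hAr hαrσ0 (k4_mass_shape_3 hϑ₂symm hk4t) p).trans hαk4m3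
  have hk4cX : ∀ z', ∑ a, ∑ b, ∑ c, (∑ u, |A u z'| * K4 a b c u) * (σ a z' * (ϑ₂ a b * ϑ₂ a c * ϑ₂ b c)) ≤ αk4c := fun p => (k4_col_internal hK40 hϑ₂1 hϑ₂symm hσA0 hσϑ₂ hAc hk4x hk4x0 p).trans hαk4c
  have hαk4cX : 0 ≤ αk4c := (mul_nonneg hk4x0 hαcσ0).trans hαk4c
  have hk5m4X : ∀ s, ∑ a, ∑ b, ∑ c, (ϑ₂ s a * ϑ₂ s b * ϑ₂ s c * ϑ₂ a b * ϑ₂ a c * ϑ₂ b c) * ∑ z', (∑ u, |A u z'| * K5 a b c s u) * σ s z' ≤ αk5m4 := fun p =>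
      (k5_mass_4 hK50 hϑ₂1 hσA0 hσϑ₂ hAr hαrσ0 (k5_mass_shape_4 hϑ₂symm hk5) p).trans hαk5m4
  have hk5cX : ∀ z', ∑ a, ∑ b, ∑ c, ∑ d, (∑ u, |A u z'| * K5 a b c d u) * (σ a z' * (ϑ₂ a b * ϑ₂ a c * ϑ₂ a d * ϑ₂ b c * ϑ₂ b d * ϑ₂ c d)) ≤ αk5c := fun p => (k5_col_internal hK50 hϑ₂1 hϑ₂symm hσA0 hσϑ₂ hAc hk5x hk5x0 p).trans
      hαk5c
  have hαk5cX : 0 ≤ αk5c := (mul_nonneg hk5x0 hαcσ0).trans hαk5c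
  exact fifth_derivative_weighted_slot_s hΓop Y hUd hU'd hU''d hU₃d hU₄d hU₅c hκ₀ hκ₁ ha hτ hδ hθ0 hθ1 hκθ hκθw hstab hU'b hU''b hU₃b hU₄b hU₅b hlam hUsec hρg hHk hHk0 hK3 hK30 hK4 hK40 hK5 hhr ψ hαr hαc hlamA hlamA1 hγ hγ1 hD hDC
      hθnn hDθr hdθ hDθc hdθ' hσ0 hσθ hρ1 hρsymm hρmul hρσ hr1 hrσ haσX hβX haσ'X hgσX hgσ'X hkσX hkσ'X hC3k hC3h hC4 hC5 hr₁1 hr₁symm hr₁mul hr₁8 hC40 hC50 hϑ1 hϑsymm hϑmul hϑ4 hϑ₂symm hϑσ6 hϑr₁ hG hΘ hS2 hhrw hhc hk3m hk3c hbσcX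
      hαθcX hg2mX hg1cX hαg1cX hk4m3X hk4cX hαk4cX hk5m4X hk5cX hαk5cX hk5 s

/-! ## Toy -/

/-- Toy (the bookkeeping in numbers): an intrinsic letter `2` and a factor letter `3` admit any profile letter `≥ 6`. -/
example : (2 : ℝ) * 3 ≤ 6 := by norm_num

end Summit.QuantumFields.BalabanUV.T4Continuum.NE7b.SupWeightedClassMapOrderFiveFive

end
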